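import Mathlib
import Literature.MathematicalPhysics.StatisticalMechanics.LocalMatchingCompactness
import Literature.Geometry.DiscreteGeometry.KissingPatterns

/-!
# `CleanLimitsHaveWindows` (stmt-AtomisticToContinuum-15932), line `Sketch` — stub G:
# everywhere-clean sets are `2a`-relatively dense

Support file for the skeleton of the crux `GappedShellCensus.CleanLimitsHaveWindows`: the stub
`stub_relDense`. A non-empty set `Z ⊆ ℝ³` which is everywhere clean at scale `a > 0` (every
site has exactly twelve neighbours in the band `[0.98a, 1.02a]`, none in `(1.02a, 1.26a)`, and
its recentred, rescaled bond shell is `1/5`-matched to a rotated copy of the fcc or the hcp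
kissing pattern) is `2a`-relatively dense: every point `y` of space is within `2a` of a site.

Proof (greedy walk along bonds). `Z` is `0.98a`-separated, so its intersection with a closed
ball is finite and a site `w` nearest to `y` exists. If `D = dist w y > 2a`, let `u` be the unit
vector from `w` towards `y`. KEY FACT about the two explicit patterns `P` (cuboctahedron,
anticuboctahedron): for every unit vector `û` some pattern point `q` has `⟪q, û⟫ ≥ 1/2`
(`exists_half_le_inner_of_mem_fcc/hcp`: with `s = û₀ + û₁ + û₂`, if `s ≥ 3√2/4` a point of the
upper triangle works, if `s ≤ -3√2/4` a point of the lower triangle, and otherwise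
`Σ (ûᵢ - ûⱼ)² = 3 - s² > 15/8` forces a coordinate difference `≥ √2/2`, i.e. a hexagon point).
Applied to `û = A⁻¹ u` (`A` the linear isometry of the shell closeness, surjective in finite
dimension) and composed with the `1/5`-matching, the shell of `w` contains a site `n` with
`⟪n - w, u⟫ ≥ (1/2 - 1/5) a` and `‖n - w‖ ≤ 1.02a`, whence
`dist n y² ≤ D² - (3/5)aD + (1.02a)² < D²` — contradicting the minimality of `w`.
-/

noncomputable section

namespace Summit.AtomisticToContinuum.Crystallization.Theorems.CleanHull

open Metric
open Literature.MathematicalPhysics.StatisticalMechanics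
open Literature.Geometry.DiscreteGeometry

/-! ## Coordinates -/

/-- The inner product of an integer vector with `u`, in coordinates. [folklore] -/
theorem inner_intVec (v : Fin 3 → ℤ) (u : EuclideanSpace ℝ (Fin 3)) :
    inner ℝ (intVec v) u = v 0 * u 0 + v 1 * u 1 + v 2 * u 2 := by
  rw [PiLp.inner_apply, Fin.sum_univ_three]
  simp only [intVec_apply, Real.inner_apply]

/-- The coordinates of a unit vector of `ℝ³` have squares summing to `1`. [folklore] -/
theorem sum_sq_eq_one_of_norm_eq_one {u : EuclideanSpace ℝ (Fin 3)} (hu : ‖u‖ = 1) :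
    u 0 ^ 2 + u 1 ^ 2 + u 2 ^ 2 = 1 := by
  have h := EuclideanSpace.real_norm_sq_eq u
  rw [hu, one_pow, Fin.sum_univ_three] at h
  exact h.symm

/-! ## Elementary trichotomy for a unit vector -/

/-- For a unit vector `(x, y, z)`: either `x + y + z ≥ 3√2/4`, or `x + y + z ≤ -3√2/4`, or two
coordinates differ by at least `√2/2` (since `Σ (xᵢ - xⱼ)² = 3 - (x + y + z)²`). [folklore] -/
theorem relDense_trichotomy (x y z : ℝ) (h : x ^ 2 + y ^ 2 + z ^ 2 = 1) :
    3 * Real.sqrt 2 / 4 ≤ x + y + z ∨ x + y + z ≤ -(3 * Real.sqrt 2 / 4) ∨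
      (Real.sqrt 2 / 2 ≤ x - y ∨ Real.sqrt 2 / 2 ≤ y - x ∨ Real.sqrt 2 / 2 ≤ x - z ∨
        Real.sqrt 2 / 2 ≤ z - x ∨ Real.sqrt 2 / 2 ≤ y - z ∨ Real.sqrt 2 / 2 ≤ z - y) := by
  by_cases h1 : 3 * Real.sqrt 2 / 4 ≤ x + y + z
  · exact Or.inl h1
  by_cases h2 : x + y + z ≤ -(3 * Real.sqrt 2 / 4)
  · exact Or.inr (Or.inl h2)
  refine Or.inr (Or.inr ?_)
  push Not at h1 h2
  have h22 : Real.sqrt 2 ^ 2 = 2 := Real.sq_sqrt (by norm_num)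
  have hs2 : (x + y + z) ^ 2 < 9 / 8 := by
    have : (x + y + z) ^ 2 < (3 * Real.sqrt 2 / 4) ^ 2 := sq_lt_sq' h2 h1
    nlinarith [h22, this]
  have hsum : (x - y) ^ 2 + (y - z) ^ 2 + (x - z) ^ 2 = 3 - (x + y + z) ^ 2 := by
    linear_combination 3 * h
  by_contra hcon
  push Not at hcon
  obtain ⟨h₁, h₂, h₃, h₄, h₅, h₆⟩ := hcon
  have hτ : (Real.sqrt 2 / 2) ^ 2 = 1 / 2 := by
    rw [div_pow, h22]; norm_num
  have e1 : (x - y) ^ 2 < 1 / 2 := by rw [← hτ]; exact sq_lt_sq' (by linarith) h₁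
  have e2 : (y - z) ^ 2 < 1 / 2 := by rw [← hτ]; exact sq_lt_sq' (by linarith) h₅
  have e3 : (x - z) ^ 2 < 1 / 2 := by rw [← hτ]; exact sq_lt_sq' (by linarith) h₃
  linarith

/-- If `x + y + z ≥ 3√2/4`, two of the coordinates sum to at least `√2/2`. [folklore] -/
theorem relDense_upper (x y z : ℝ) (hs : 3 * Real.sqrt 2 / 4 ≤ x + y + z) :
    Real.sqrt 2 / 2 ≤ x + y ∨ Real.sqrt 2 / 2 ≤ x + z ∨ Real.sqrt 2 / 2 ≤ y + z := by
  by_contra hcon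
  push Not at hcon
  obtain ⟨h₁, h₂, h₃⟩ := hcon
  linarith

/-- If `x + y + z ≤ -3√2/4`, two of the coordinates sum to at most `-√2/2`. [folklore] -/
theorem relDense_lower_fcc (x y z : ℝ) (hs : x + y + z ≤ -(3 * Real.sqrt 2 / 4)) :
    Real.sqrt 2 / 2 ≤ -x - y ∨ Real.sqrt 2 / 2 ≤ -x - z ∨ Real.sqrt 2 / 2 ≤ -y - z := by
  by_contra hcon
  push Not at hcon
  obtain ⟨h₁, h₂, h₃⟩ := hcon
  linarith

/-- If `x + y + z ≤ -3√2/4`, one of the three linear forms of the lower hcp triangle is at least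
`√2/2`. [folklore] -/
theorem relDense_lower_hcp (x y z : ℝ) (hs : x + y + z ≤ -(3 * Real.sqrt 2 / 4)) :
    Real.sqrt 2 / 2 ≤ (-x - y - 4 * z) / 3 ∨ Real.sqrt 2 / 2 ≤ (-x - 4 * y - z) / 3 ∨
      Real.sqrt 2 / 2 ≤ (-4 * x - y - z) / 3 := by
  by_contra hcon
  push Not at hcon
  obtain ⟨h₁, h₂, h₃⟩ := hcon
  linarith

/-! ## The key fact about the two patterns -/

/-- A point of the fcc pattern from an integer vector of `fccInt` whose linear form is `≥ √2/2`
at `u` has inner product `≥ 1/2` with `u`. [folklore] -/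
theorem relDense_point_fcc (k l m : ℤ) (hv : (![k, l, m] : Fin 3 → ℤ) ∈ fccInt)
    {u : EuclideanSpace ℝ (Fin 3)} (h : Real.sqrt 2 / 2 ≤ k * u 0 + l * u 1 + m * u 2) :
    ∃ q ∈ fccKissingPattern, 1 / 2 ≤ inner ℝ q u := by
  refine ⟨_, Finset.mem_image_of_mem _ hv, ?_⟩
  have e : ((![k, l, m] : Fin 3 → ℤ) 0 : ℝ) * u 0 + ((![k, l, m] : Fin 3 → ℤ) 1 : ℝ) * u 1
      + ((![k, l, m] : Fin 3 → ℤ) 2 : ℝ) * u 2 = k * u 0 + l * u 1 + m * u 2 := by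
    simp
  have h2 : Real.sqrt ((2 : ℕ) : ℝ) = Real.sqrt 2 := by norm_num
  rw [real_inner_smul_left, inner_intVec, e, h2, le_inv_mul_iff₀ (by positivity)]
  linarith

/-- A point of the hcp pattern from an integer vector of `hcpInt` whose linear form is
`≥ 3√2/2` at `u` has inner product `≥ 1/2` with `u` (`√18 = 3√2`). [folklore] -/
theorem relDense_point_hcp (k l m : ℤ) (hv : (![k, l, m] : Fin 3 → ℤ) ∈ hcpInt)
    {u : EuclideanSpace ℝ (Fin 3)}
    (h : Real.sqrt 2 / 2 ≤ (k * u 0 + l * u 1 + m * u 2) / 3) :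
    ∃ q ∈ hcpKissingPattern, 1 / 2 ≤ inner ℝ q u := by
  refine ⟨_, Finset.mem_image_of_mem _ hv, ?_⟩
  have e : ((![k, l, m] : Fin 3 → ℤ) 0 : ℝ) * u 0 + ((![k, l, m] : Fin 3 → ℤ) 1 : ℝ) * u 1
      + ((![k, l, m] : Fin 3 → ℤ) 2 : ℝ) * u 2 = k * u 0 + l * u 1 + m * u 2 := by
    simp
  have h18 : Real.sqrt ((18 : ℕ) : ℝ) = 3 * Real.sqrt 2 := by
    rw [show ((18 : ℕ) : ℝ) = 3 ^ 2 * 2 by norm_num, Real.sqrt_mul (by norm_num) 2,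
      Real.sqrt_sq (by norm_num)]
  rw [real_inner_smul_left, inner_intVec, e, h18, le_inv_mul_iff₀ (by positivity)]
  linarith

/-- **Key fact, fcc.** For every unit vector `u` some point of the fcc kissing pattern
(cuboctahedron `(±1, ±1, 0)/√2` and permutations) has inner product `≥ 1/2` with `u`. [folklore] -/
theorem exists_half_le_inner_of_mem_fcc (u : EuclideanSpace ℝ (Fin 3)) (hu : ‖u‖ = 1) :
    ∃ q ∈ fccKissingPattern, 1 / 2 ≤ inner ℝ q u := by
  have h := sum_sq_eq_one_of_norm_eq_one hu
  rcases relDense_trichotomy (u 0) (u 1) (u 2) h with hs | hs | hh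
  · rcases relDense_upper _ _ _ hs with h1 | h1 | h1
    · exact relDense_point_fcc 1 1 0 (by decide) (by push_cast; linarith)
    · exact relDense_point_fcc 1 0 1 (by decide) (by push_cast; linarith)
    · exact relDense_point_fcc 0 1 1 (by decide) (by push_cast; linarith)
  · rcases relDense_lower_fcc _ _ _ hs with h1 | h1 | h1
    · exact relDense_point_fcc (-1) (-1) 0 (by decide) (by push_cast; linarith)
    · exact relDense_point_fcc (-1) 0 (-1) (by decide) (by push_cast; linarith)
    · exact relDense_point_fcc 0 (-1) (-1) (by decide) (by push_cast; linarith)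
  · rcases hh with h1 | h1 | h1 | h1 | h1 | h1
    · exact relDense_point_fcc 1 (-1) 0 (by decide) (by push_cast; linarith)
    · exact relDense_point_fcc (-1) 1 0 (by decide) (by push_cast; linarith)
    · exact relDense_point_fcc 1 0 (-1) (by decide) (by push_cast; linarith)
    · exact relDense_point_fcc (-1) 0 1 (by decide) (by push_cast; linarith)
    · exact relDense_point_fcc 0 1 (-1) (by decide) (by push_cast; linarith)
    · exact relDense_point_fcc 0 (-1) 1 (by decide) (by push_cast; linarith)

/-- **Key fact, hcp.** For every unit vector `u` some point of the hcp kissing pattern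
(anticuboctahedron) has inner product `≥ 1/2` with `u`. [folklore] -/
theorem exists_half_le_inner_of_mem_hcp (u : EuclideanSpace ℝ (Fin 3)) (hu : ‖u‖ = 1) :
    ∃ q ∈ hcpKissingPattern, 1 / 2 ≤ inner ℝ q u := by
  have h := sum_sq_eq_one_of_norm_eq_one hu
  rcases relDense_trichotomy (u 0) (u 1) (u 2) h with hs | hs | hh
  · rcases relDense_upper _ _ _ hs with h1 | h1 | h1
    · exact relDense_point_hcp 3 3 0 (by decide) (by push_cast; linarith)
    · exact relDense_point_hcp 3 0 3 (by decide) (by push_cast; linarith)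
    · exact relDense_point_hcp 0 3 3 (by decide) (by push_cast; linarith)
  · rcases relDense_lower_hcp _ _ _ hs with h1 | h1 | h1
    · exact relDense_point_hcp (-1) (-1) (-4) (by decide) (by push_cast; linarith)
    · exact relDense_point_hcp (-1) (-4) (-1) (by decide) (by push_cast; linarith)
    · exact relDense_point_hcp (-4) (-1) (-1) (by decide) (by push_cast; linarith)
  · rcases hh with h1 | h1 | h1 | h1 | h1 | h1
    · exact relDense_point_hcp 3 (-3) 0 (by decide) (by push_cast; linarith)
    · exact relDense_point_hcp (-3) 3 0 (by decide) (by push_cast; linarith)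
    · exact relDense_point_hcp 3 0 (-3) (by decide) (by push_cast; linarith)
    · exact relDense_point_hcp (-3) 0 3 (by decide) (by push_cast; linarith)
    · exact relDense_point_hcp 0 3 (-3) (by decide) (by push_cast; linarith)
    · exact relDense_point_hcp 0 (-3) 3 (by decide) (by push_cast; linarith)

/-! ## The stub -/

/-- **Stub G (relative denseness of clean sets).** A non-empty everywhere-clean set at scale `a > 0` is
`2a`-relatively dense: every point of space is within `2a` of a site (greedy walk along bonds: the
fcc/hcp-close shell of every site has a point making progress `≥ 3a/10` in every direction). [folklore] -/
theorem stub_relDense (a : ℝ) (ha : 0 < a) (Z : Set (EuclideanSpace ℝ (Fin 3))) (hne : Z.Nonempty)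
    (hclean : ∀ y ∈ Z, ({w ∈ Z | w ≠ y ∧ dist y w ≤ a * (1 + 1 / 50)}.ncard = 12 ∧
        ∀ w ∈ Z, w ≠ y → a * (1 - 1 / 50) ≤ dist y w ∧
          (dist y w ≤ a * (1 + 1 / 50) ∨ a * (63 / 50) ≤ dist y w)) ∧
      ∃ T : Finset (EuclideanSpace ℝ (Fin 3)), (↑T : Set (EuclideanSpace ℝ (Fin 3))) =
          (fun w => a⁻¹ • (w - y)) '' {w ∈ Z | w ≠ y ∧ dist y w ≤ a * (1 + 1 / 50)} ∧
        (ShellCloseTo (1 / 5) T fccKissingPattern ∨ ShellCloseTo (1 / 5) T hcpKissingPattern)) :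
    ∀ y : EuclideanSpace ℝ (Fin 3), ∃ w ∈ Z, dist w y ≤ 2 * a := by
  intro y
  obtain ⟨z₀, hz₀⟩ := hne
  -- `Z` is `a(1 - 1/50)`-separated
  have hsep : ∀ p ∈ Z, ∀ q ∈ Z, p ≠ q → a * (1 - 1 / 50) ≤ dist p q :=
    fun p hp q hq hpq => ((hclean p hp).1.2 q hq (Ne.symm hpq)).1
  -- the sites no farther from `y` than `z₀` form a finite non-empty set: minimise the distance
  have hSfin : (Z ∩ closedBall y (dist z₀ y)).Finite :=
    finite_of_forall_le_dist_of_subset_closedBall (by positivity : (0 : ℝ) < a * (1 - 1 / 50))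
      (fun p hp q hq hpq => hsep p hp.1 q hq.1 hpq) Set.inter_subset_right
  have hz₀S : z₀ ∈ hSfin.toFinset := by
    rw [Set.Finite.mem_toFinset]
    exact ⟨hz₀, mem_closedBall.2 le_rfl⟩
  obtain ⟨w, hwS, hwmin⟩ := hSfin.toFinset.exists_min_image (fun p => dist p y) ⟨z₀, hz₀S⟩
  rw [Set.Finite.mem_toFinset] at hwS
  have hwZ : w ∈ Z := hwS.1
  have hmin : ∀ z ∈ Z, dist w y ≤ dist z y := by
    intro z hz
    by_cases hzb : dist z y ≤ dist z₀ y
    · exact hwmin z ((Set.Finite.mem_toFinset _).2 ⟨hz, mem_closedBall.2 hzb⟩)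
    · exact (hwmin z₀ hz₀S).trans (le_of_lt (not_le.1 hzb))
  refine ⟨w, hwZ, ?_⟩
  by_contra hD
  rw [not_le] at hD
  set D := dist w y with hDdef
  have hD0 : 0 < D := by linarith
  have hvn : ‖y - w‖ = D := by rw [hDdef, dist_eq_norm, norm_sub_rev]
  -- the shell of `w`: a pattern with the key fact, an isometry and a matching
  obtain ⟨⟨-, -⟩, T, hT, hclose⟩ := hclean w hwZ
  obtain ⟨P, A, hP, e, he⟩ : ∃ (P : Finset (EuclideanSpace ℝ (Fin 3)))
      (A : EuclideanSpace ℝ (Fin 3) →ₗᵢ[ℝ] EuclideanSpace ℝ (Fin 3)),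
      (∀ u : EuclideanSpace ℝ (Fin 3), ‖u‖ = 1 → ∃ q ∈ P, 1 / 2 ≤ inner ℝ q u) ∧
        EtaMatched (1 / 5) T (P.image A) := by
    rcases hclose with ⟨A, hA⟩ | ⟨A, hA⟩
    · exact ⟨_, A, exists_half_le_inner_of_mem_fcc, hA⟩
    · exact ⟨_, A, exists_half_le_inner_of_mem_hcp, hA⟩
  -- the unit vector towards `y`, pulled back by `A` (surjective: finite dimension)
  obtain ⟨u', hu'n, hAu'⟩ : ∃ u' : EuclideanSpace ℝ (Fin 3), ‖u'‖ = 1 ∧ A u' = D⁻¹ • (y - w) := by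
    refine ⟨(A.toLinearIsometryEquiv rfl).symm (D⁻¹ • (y - w)), ?_,
      (A.toLinearIsometryEquiv rfl).apply_symm_apply _⟩
    rw [LinearIsometryEquiv.norm_map, norm_smul, norm_inv, Real.norm_eq_abs, abs_of_pos hD0, hvn,
      inv_mul_cancel₀ hD0.ne']
  obtain ⟨q, hqP, hq⟩ := hP u' hu'n
  have hAq : A q ∈ P.image A := Finset.mem_image_of_mem A hqP
  -- the matched shell point `t`
  obtain ⟨t, htT, htq⟩ : ∃ t : EuclideanSpace ℝ (Fin 3),
      t ∈ (↑T : Set (EuclideanSpace ℝ (Fin 3))) ∧ dist t (A q) ≤ 1 / 5 :=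
    ⟨(e.symm ⟨A q, hAq⟩ : ↥T), Finset.mem_coe.2 (e.symm ⟨A q, hAq⟩).2,
      by simpa using he (e.symm ⟨A q, hAq⟩)⟩
  -- `t` makes progress `≥ 3D/10` along `y - w`
  have hinnerAq : inner ℝ (A q) (y - w) = D * inner ℝ q u' := by
    have h1 : inner ℝ (A q) (A u') = inner ℝ q u' := A.inner_map_map q u'
    rw [hAu', real_inner_smul_right] at h1
    rw [← h1, ← mul_assoc, mul_inv_cancel₀ hD0.ne', one_mul]
  have htv : 3 / 10 * D ≤ inner ℝ t (y - w) := by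
    have h1 : inner ℝ t (y - w) = inner ℝ (A q) (y - w) + inner ℝ (t - A q) (y - w) := by
      rw [inner_sub_left]; ring
    have h2 : |inner ℝ (t - A q) (y - w)| ≤ ‖t - A q‖ * ‖y - w‖ := abs_real_inner_le_norm _ _
    rw [hvn, ← dist_eq_norm] at h2
    have h3 := (abs_le.1 h2).1
    have h4 : dist t (A q) * D ≤ 1 / 5 * D := mul_le_mul_of_nonneg_right htq hD0.le
    have h5 : D * (1 / 2) ≤ D * inner ℝ q u' := mul_le_mul_of_nonneg_left hq hD0.le
    rw [h1, hinnerAq]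
    linarith
  -- the actual neighbour `n = w + a t ∈ Z`
  rw [hT] at htT
  obtain ⟨n, ⟨hnZ, -, hdn⟩, hnt⟩ := htT
  have hnt' : a⁻¹ • (n - w) = t := hnt
  have hpt : n - w = a • t := by rw [← hnt', smul_smul, mul_inv_cancel₀ ha.ne', one_smul]
  have hpn : ‖n - w‖ ≤ a * (1 + 1 / 50) := by rw [← dist_eq_norm, dist_comm]; exact hdn
  have hpv : 3 / 10 * a * D ≤ inner ℝ (n - w) (y - w) := by
    rw [hpt, real_inner_smul_left]
    have := mul_le_mul_of_nonneg_left htv ha.le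
    linarith
  have hny : dist n y = ‖(n - w) - (y - w)‖ := by
    rw [sub_sub_sub_cancel_right, dist_eq_norm]
  have hsq : ‖(n - w) - (y - w)‖ ^ 2 < D ^ 2 := by
    rw [norm_sub_sq_real, hvn]
    have hp2 : ‖n - w‖ ^ 2 ≤ (a * (1 + 1 / 50)) ^ 2 := pow_le_pow_left₀ (norm_nonneg _) hpn 2
    have haD : a * (2 * a) < a * D := mul_lt_mul_of_pos_left hD ha
    nlinarith [hp2, hpv, haD, sq_nonneg a]
  have hlt : dist n y < D := by
    rw [hny]
    exact lt_of_pow_lt_pow_left₀ 2 hD0.le hsq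
  exact absurd (hmin n hnZ) (not_le.2 hlt)

end Summit.AtomisticToContinuum.Crystallization.Theorems.CleanHull
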